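import Summits.Ventures.WeilGRH.UniformConductorFloorGalerkinTab
import Summits.Ventures.WeilGRH.UniformConductorFloorLog12TableValid
import HarnessLib

/-!
# GRH arm (rh-explicit, venture WeilGRH): the principal character mod `277` FAILS Weil positivity on `[-(log 12)/2, (log 12)/2]` — a TABLE-BASED
  `40`-mode kernel Galerkin witness (the razor prime of rung six)

Cell `rh-explicit`, WEIL TRACK — GRH ARM (weil-grh-1, gen9).  At the window `(log 12)/2` (prime powers `2, 3, 4, 5, 7, 8, 9, 11`) the prime `277` is the RAZOR case of
the principal dichotomy: it lies above the flat threshold `271.53` of the coprime pattern and above the 16-mode Galerkin bottom `276.51`, but below the bottoms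
`277.02 / 277.05 / 277.08 / 277.13` of the `28 / 32 / 40 / 48`-mode even sections (float) — so `χ₀` mod `277` fails, by a margin of only `≈ 3.0·10⁻⁴` in `log q` at
`K = 40` (`1.8·10⁻⁴` at `K = 32`).  This file certifies an integer `40`-mode witness (bottom eigenvector of the `40`-mode section at `q = 277`, scale `10⁷`; float form/‖c‖² = `-2.984e-04`) with
weil-grh-1's TABLE-BASED refutation `UniformFloor.galerkinCheckTab` / `not_weilPositivityOnChar_of_galerkinCheckTab` (`UniformConductorFloorGalerkinTab.lean`) on the
certified special-value table `Log12Table.tab` (`UniformConductorFloorLog12Table.lean`, `tab_valid` below `128`): only the `41·81` entry boxes are evaluated in the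
kernel.  Third rung in a row (after `167` at `(log 10)/2` with 32 modes and `211` at `(log 11)/2` with 16) where the largest failing prime survives Yoshida's flat window.
RH/GRH-free (principal characters carry no polar term by the tree's convention); no definitions; standard axioms.

## References

* H. Yoshida, *On Hermitian forms attached to zeta functions*, Adv. Stud. Pure Math. 21 (1992) 281–325, §3, §5 (5.15)/(5.16) p. 301. [Yoshida1992HermitianForms]
* R. E. Moore, *Interval Analysis* (1966), Ch. 3. [Moore1966]
* A. Weil, *Sur les "formules explicites" de la théorie des nombres premiers* (1952), (11) pp. 261–262. [Weil1952FormulesExplicites]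
-/

set_option autoImplicit false

open scoped ComplexConjugate

namespace Summit.Ventures.WeilGRH

open Literature.NumberTheory.LFunctions Literature.NumberTheory.LFunctions.Yoshida1992
open Literature.NumberTheory.LFunctions.Yoshida1992.Encl
open Literature.Analysis.ValidatedNumerics.NumericsMP
open Summit.Ventures.WeilGRH.Log12Table

namespace UniformFloor

set_option maxHeartbeats 0 in
set_option maxRecDepth 200000 in
/-- kernel: the table-based 40-mode Galerkin witness for `χ₀` mod `277` at `(log 12)/2` (all eight prime powers coprime: `ε = 1`; `log 277` by `MI.logNat`).
[cite: Moore1966, Ch. 3 (interval arithmetic: inclusion property)] -/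
theorem galerkinTab_log12half_277 :
    ((MI.logNat (2 ^ 80) 96 277).elim false fun LQ ↦
      galerkinCheckTab (2 ^ 80) C tab LQ [1, 1, 1, 1, 1, 1, 1, 1]
      [-9983372, 319915, -36456, -23547, 57445, -130851, -105062, -9721, 99291, 22864,
      -33035, -9661, 21426, -22799, 31138, 7553, 55401, -40558, 30444, -31303,
      -10814, -12234, 64165, -44911, 9287, -37867, 21016, -17790, 10610, 7450,
      19282, -13092, 3277, -7271, 2046, 3241, 15921, -1651, -15712, -8070,
      11499] 40) = true := by
  decide +kernel

/-- ★★ **The principal character mod `277` FAILS Weil positivity on `[−(log 12)/2, (log 12)/2]`.** [cite: Yoshida1992HermitianForms, §5 (5.15)-(5.16) p. 301] -/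
theorem not_weilPositivityOnChar_log12half_principal_mod_277 :
    ¬ WeilPositivityOnChar (1 : DirichletCharacter ℂ 277) (Real.log 12 / 2) := by
  have hfact := galerkinTab_log12half_277
  cases hL : MI.logNat (2 ^ 80) 96 277 with
  | none => rw [hL] at hfact; simp at hfact
  | some LQ =>
    rw [hL, Option.elim_some] at hfact
    have hLQ : MI.mem (2 ^ 80) (Real.log ((277 : ℕ) : ℝ)) LQ := MI.mem_logNat (by norm_num) hL
    have hreal : ∀ n : ℕ, conj ((1 : DirichletCharacter ℂ 277) (n : ZMod 277)) = (1 : DirichletCharacter ℂ 277) (n : ZMod 277) := by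
      intro n
      by_cases hx : IsUnit ((n : ℕ) : ZMod 277)
      · rw [MulChar.one_apply hx, map_one]
      · rw [MulChar.map_nonunit _ hx, map_zero]
    have heven : charParity (1 : DirichletCharacter ℂ 277) = 0 :=
      charParity_of_even (show (1 : DirichletCharacter ℂ 277) (-1) = 1 from MulChar.one_apply isUnit_one.neg)
    have hε : ∀ i < ks.length, ((1 : DirichletCharacter ℂ 277) (((ks.getD i default).val : ℕ) : ZMod 277)).re =
        (([1, 1, 1, 1, 1, 1, 1, 1].getD i 0 : ℤ) : ℝ) := by
      intro i hi
      have hi8 : i < 8 := by simpa [ks] using hi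
      interval_cases i
      · show ((1 : DirichletCharacter ℂ 277) (((PrimeLen.val ⟨2, 1⟩ : ℕ)) : ZMod 277)).re = (((1 : ℤ)) : ℝ)
        rw [show (PrimeLen.val ⟨2, 1⟩ : ℕ) = 2 from rfl,
          MulChar.one_apply (show IsUnit ((2 : ℕ) : ZMod 277) by rw [ZMod.isUnit_iff_coprime]; decide)]
        simp
      · show ((1 : DirichletCharacter ℂ 277) (((PrimeLen.val ⟨3, 1⟩ : ℕ)) : ZMod 277)).re = (((1 : ℤ)) : ℝ)
        rw [show (PrimeLen.val ⟨3, 1⟩ : ℕ) = 3 from rfl,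
          MulChar.one_apply (show IsUnit ((3 : ℕ) : ZMod 277) by rw [ZMod.isUnit_iff_coprime]; decide)]
        simp
      · show ((1 : DirichletCharacter ℂ 277) (((PrimeLen.val ⟨2, 2⟩ : ℕ)) : ZMod 277)).re = (((1 : ℤ)) : ℝ)
        rw [show (PrimeLen.val ⟨2, 2⟩ : ℕ) = 4 from rfl,
          MulChar.one_apply (show IsUnit ((4 : ℕ) : ZMod 277) by rw [ZMod.isUnit_iff_coprime]; decide)]
        simp
      · show ((1 : DirichletCharacter ℂ 277) (((PrimeLen.val ⟨5, 1⟩ : ℕ)) : ZMod 277)).re = (((1 : ℤ)) : ℝ)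
        rw [show (PrimeLen.val ⟨5, 1⟩ : ℕ) = 5 from rfl,
          MulChar.one_apply (show IsUnit ((5 : ℕ) : ZMod 277) by rw [ZMod.isUnit_iff_coprime]; decide)]
        simp
      · show ((1 : DirichletCharacter ℂ 277) (((PrimeLen.val ⟨7, 1⟩ : ℕ)) : ZMod 277)).re = (((1 : ℤ)) : ℝ)
        rw [show (PrimeLen.val ⟨7, 1⟩ : ℕ) = 7 from rfl,
          MulChar.one_apply (show IsUnit ((7 : ℕ) : ZMod 277) by rw [ZMod.isUnit_iff_coprime]; decide)]
        simp
      · show ((1 : DirichletCharacter ℂ 277) (((PrimeLen.val ⟨2, 3⟩ : ℕ)) : ZMod 277)).re = (((1 : ℤ)) : ℝ)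
        rw [show (PrimeLen.val ⟨2, 3⟩ : ℕ) = 8 from rfl,
          MulChar.one_apply (show IsUnit ((8 : ℕ) : ZMod 277) by rw [ZMod.isUnit_iff_coprime]; decide)]
        simp
      · show ((1 : DirichletCharacter ℂ 277) (((PrimeLen.val ⟨3, 2⟩ : ℕ)) : ZMod 277)).re = (((1 : ℤ)) : ℝ)
        rw [show (PrimeLen.val ⟨3, 2⟩ : ℕ) = 9 from rfl,
          MulChar.one_apply (show IsUnit ((9 : ℕ) : ZMod 277) by rw [ZMod.isUnit_iff_coprime]; decide)]
        simp
      · show ((1 : DirichletCharacter ℂ 277) (((PrimeLen.val ⟨11, 1⟩ : ℕ)) : ZMod 277)).re = (((1 : ℤ)) : ℝ)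
        rw [show (PrimeLen.val ⟨11, 1⟩ : ℕ) = 11 from rfl,
          MulChar.one_apply (show IsUnit ((11 : ℕ) : ZMod 277) by rw [ZMod.isUnit_iff_coprime]; decide)]
        simp
    have h := not_weilPositivityOnChar_of_galerkinCheckTab (by norm_num) a_pos primeData consts_valid tab_valid (by norm_num : 40 < 128)
      hLQ hfact (by norm_num) 1 hreal heven hε
    simpa only [a] using h

/-- **So the all-characters statement at `(log 12)/2` fails at `p = 277`.** [cite: Weil1952FormulesExplicites, (11) pp. 261–262] -/
theorem exists_not_weilPositivityOnChar_log12half_mod_277 :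
    ∃ χ : DirichletCharacter ℂ 277, ¬ WeilPositivityOnChar χ (Real.log 12 / 2) :=
  ⟨1, not_weilPositivityOnChar_log12half_principal_mod_277⟩

end UniformFloor

end Summit.Ventures.WeilGRH
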